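import Mathlib
import Summits.MatrixMultiplication.Statement
import Summits.MatrixMultiplication.MatrixMultiplication.Theorems.GraphEquationsQuadricTests
import Summits.MatrixMultiplication.MatrixMultiplication.Theorems.GraphEquationsCubicMasking

/-!
# Graph equations — the CUBIC RUNG of the degree ladder (Conjecture C3, typed)

M35 (decomp-mm-lens-5 g37; supports the attacked crux `MultiplicityReduction`,
stmt-MatrixMultiplication-27806, route `GraphEquations`).  No sorry.

The lens «finite range + asymptotic regime + bridge» indexes the PROVED finite range of `H_mult` by the
DEGREE of the tests (NODE-g37 §2):
* rung `2` — `GraphEquationsQuadricTests`: a correct QUADRATIC system is reduced at the origin (PROVED);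
* rung `3` — THIS FILE types Conjecture C3 = `CubicReduction n`: «a correct CUBIC system for `W_n` is
  generically reduced» — UNDECIDED(test: instrument `decomp-mm-lens-5/g37/cubic_ideal_n.py`: at
  `n = 2, 3` the structure count of `I(W_n)_{≤3}` is verified (`55 = 4+32+19`, `252 = 9+162+81`, no
  weight-5/6 part) and every sampled polynomial kernel field — constant, linear, Koszul and non-Koszul
  syzygy, rank-one, random; `92/92` at `n = 2`, `54/54` at `n = 3` — fails to carry a correct cubic
  system; the hardest case is the formal record `GraphEquationsCubicMasking`: masked at every graph
  point, correct off the isotropic cone, not correct over `ℂ`);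
* rung `4` — `GraphEquationsMaskingWitness`: a correct degree-`4` family nowhere lowest-form
  nondegenerate (the strong form of the rung is REFUTED; its unmasking cost is `1`,
  `GraphEquationsUnmasking`).
Contents: `EqSystem.IsCubic`; `CubicReduction n` (C3ₙ) and what it buys on the dial
(`tensorRank_le_of_isCubic`, `eqAdmissibleRed_of_eqAdmissibleCubic`, `omega_le_of_eqAdmissibleCubic`
— exact rank, multiplier `1`, like rung `2`); C3 holds on the quadratic sub-range
(`CubicReduction.of_isQuadratic_fragment`); and the CONSISTENCY of the cubic masked family with C3₂
(`cubicMaskedFamily_consistent_with_C3`: it is cubic and nowhere reduced, and — as C3 predicts — not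
correct).  Why strictly weaker than the summit: C3 is a statement about cubic polynomial systems for a
fixed `n`, with no cost and no exponent in it; it neither implies nor is implied by `ω = 2` by any
theorem in the tree.  Tags: `CubicReduction` UNDECIDED(test) · INSTRUMENTABLE (`n = 2` by elimination
over the minors of the row span, kit) · IDEA-NEEDED (all `n`: control of the special fibres — isotropic
cones, `{L₀·φ = 0}` — any proof must use that `ℂ` is algebraically closed).
-/

-- dupNamespace: forced by the nested Summit.MatrixMultiplication.MatrixMultiplication layout (D-0017)
set_option linter.dupNamespace false

noncomputable section

namespace Summit.MatrixMultiplication.MatrixMultiplication.Theorems.GraphEquations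

open MvPolynomial Matrix Literature.Computability.AlgebraicComplexity

variable {n : ℕ}

namespace EqSystem

/-- CUBIC system: every test has total degree `≤ 3`. -/
def IsCubic (E : EqSystem n) : Prop :=
  ∀ o : Fin E.tests.length, (E.testPoly (E.tests.get o)).totalDegree ≤ 3

/-- A quadratic system is cubic. -/
theorem IsQuadratic.isCubic {E : EqSystem n} (h : E.IsQuadratic) : E.IsCubic :=
  fun o => (h o).trans (by norm_num)

/-- A system whose tests are the cubic masked family is cubic. -/
theorem isCubic_of_tests_eq_cubicMaskedFamily {E : EqSystem 2} (hlen : E.tests.length = 5)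
    (hE : ∀ o : Fin E.tests.length, E.testPoly (E.tests.get o) = cubicMaskedFamily (Fin.cast hlen o)) :
    E.IsCubic := fun o => by
  rw [hE]; exact cubicMaskedFamily_totalDegree_le _

end EqSystem

/-- **Conjecture C3ₙ (rung `3` of the degree ladder).**  Every correct CUBIC equation system for the
graph `W_n` is generically reduced.  UNDECIDED(test: `cubic_ideal_n.py`, `GraphEquationsCubicMasking`);
INSTRUMENTABLE at `n = 2`; IDEA-NEEDED for all `n`. -/
def CubicReduction (n : ℕ) : Prop :=
  ∀ E : EqSystem n, E.Correct → E.IsCubic → E.GenericallyReduced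

/-- C3 holds on the quadratic sub-range (rung `2`, `GraphEquationsQuadricTests`). -/
theorem CubicReduction.of_isQuadratic_fragment (E : EqSystem n) (hE : E.Correct)
    (h2 : E.IsQuadratic) : E.GenericallyReduced :=
  EqSystem.genericallyReduced_of_isQuadratic hE h2

/-- **What C3ₙ buys: `R(⟨n,n,n⟩) ≤ 2 · cost` for every correct cubic system** (exact rank,
multiplier `1`; `reducedSystemsCostRankCost_holds`). -/
theorem tensorRank_le_of_isCubic (h3 : CubicReduction n) {E : EqSystem n} (hE : E.Correct)
    (hc : E.IsCubic) : tensorRank (matMulTensor ℂ n n n) ≤ 2 * E.cost :=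
  reducedSystemsCostRankCost_holds n E hE (h3 E hE hc)

/-- `EqAdmissibleCubic β`: correct CUBIC systems of cost `O(n^β)` exist for all `n ≥ 1`. -/
def EqAdmissibleCubic (β : ℝ) : Prop :=
  ∃ c : ℝ, ∀ n : ℕ, 1 ≤ n → ∃ E : EqSystem n, E.Correct ∧ E.IsCubic ∧
    (E.cost : ℝ) ≤ c * (n : ℝ) ^ β

/-- The quadratic range lies in the cubic range. -/
theorem EqAdmissibleQuad.eqAdmissibleCubic {β : ℝ} (h : EqAdmissibleQuad β) : EqAdmissibleCubic β := by
  obtain ⟨c, hc⟩ := h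
  refine ⟨c, fun n hn => ?_⟩
  obtain ⟨E, hE, h2, hcost⟩ := hc n hn
  exact ⟨E, hE, h2.isCubic, hcost⟩

/-- Cubic admissibility implies admissibility. -/
theorem EqAdmissibleCubic.eqAdmissible {β : ℝ} (h : EqAdmissibleCubic β) : EqAdmissible β := by
  obtain ⟨c, hc⟩ := h
  refine ⟨c, fun n hn => ?_⟩
  obtain ⟨E, hE, -, hcost⟩ := hc n hn
  exact ⟨E, hE, hcost⟩

/-- **`H_mult` on the cubic range under C3, with NO exponent loss.** -/
theorem eqAdmissibleRed_of_eqAdmissibleCubic (h3 : ∀ n, CubicReduction n) {β : ℝ}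
    (h : EqAdmissibleCubic β) : EqAdmissibleRed β := by
  obtain ⟨c, hc⟩ := h
  refine ⟨c, fun n hn => ?_⟩
  obtain ⟨E, hE, hcub, hcost⟩ := hc n hn
  exact ⟨E, hE, h3 n E hE hcub, hcost⟩

/-- **Under C3, cheap correct CUBIC systems force fast multiplication: `ω ≤ β`.** -/
theorem omega_le_of_eqAdmissibleCubic (h3 : ∀ n, CubicReduction n) {β : ℝ} (hβ : 2 ≤ β)
    (h : EqAdmissibleCubic β) : omega ℂ ≤ β :=
  reducedEquationsForceMultiplication_holds β hβ (eqAdmissibleRed_of_eqAdmissibleCubic h3 h)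

/-- **The cubic masked family is CONSISTENT with C3₂**: it is cubic and reduced at NO graph point —
and, exactly as C3₂ predicts, it is not correct over `ℂ` (the isotropic extra zero of
`GraphEquationsCubicMasking`).  So the degree-`4` masking mechanism does not descend to degree `3`
through rank-one kernel fields. -/
theorem cubicMaskedFamily_consistent_with_C3 {E : EqSystem 2} (hlen : E.tests.length = 5)
    (hE : ∀ o : Fin E.tests.length, E.testPoly (E.tests.get o) = cubicMaskedFamily (Fin.cast hlen o)) :
    E.IsCubic ∧ (∀ x ∈ mmGraph 2, ¬ E.ReducedAt x) ∧ ¬ E.GenericallyReduced ∧ ¬ E.Correct :=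
  ⟨EqSystem.isCubic_of_tests_eq_cubicMaskedFamily hlen hE,
    fun _ hx => EqSystem.not_reducedAt_of_tests_eq hlen hE hx,
    EqSystem.not_genericallyReduced_of_tests_eq hlen hE, EqSystem.not_correct_of_tests_eq hlen hE⟩

/-- Contrapositive reading used by the instrument: under C3ₙ a cubic system reduced at no graph point
is NOT correct — a counterexample to C3 must be a correct cubic system all of whose graph points are
masked. -/
theorem not_correct_of_cubic_of_nowhere_reduced (h3 : CubicReduction n) {E : EqSystem n}
    (hc : E.IsCubic) (hno : ∀ x ∈ mmGraph n, ¬ E.ReducedAt x) : ¬ E.Correct := fun hE => by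
  obtain ⟨x, hx, hred⟩ := h3 E hE hc
  exact hno x hx hred

end Summit.MatrixMultiplication.MatrixMultiplication.Theorems.GraphEquations

end
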